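import Literature.MathematicalPhysics.QuantumFieldTheory.QCDOS
import Literature.MathematicalPhysics.QuantumFieldTheory.QCDTimeReflectionProofs
import HarnessLib

/-!
# The Osterwalder–Seiler reflection law of the pseudoscalar insertions

Stub `stub_meson_reflect` of the line `Sketch` (reshape r3e, thermal re-basing) for the crux
`QuarksAsStableAction.StableActionBridge` (stmt-QuantumFields-9737): for the MESON species the
`Θ`-symmetrisation of the insertions is trivial,
  `Θ_T (insertion (Θ'U) (pseudoRe f g) (θ₀ y)) = insertion U (pseudoRe f g) y`,
  `Θ_T (insertion (Θ'U) (pseudoIm f g) (θ₀ y)) = insertion U (pseudoIm f g) y`.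

Proof.  `Θ_T` (`torusTheta`) is antilinear and order reversing with
`Θ_T ψ_{f,x,a,α} = ∑_β ψ̄_{f,θx,a,β} (γ₀)_{βα}`, `Θ_T ψ̄_{f,x,a,α} = ∑_β (γ₀)_{αβ} ψ_{f,θx,a,β}`
(`torusTheta_q`, `torusTheta_qbar`), so the pseudoscalar density
`P_{fg}(x) = ∑ ψ̄_{f,x,a,α} (iγ₅)_{αβ} ψ_{g,x,a,β}` goes to `ψ̄_g(θx) (γ₀ (iγ₅)† γ₀) ψ_f(θx) = P_{gf}(θx)`
because `γ₅ = diag(1,1,−1,−1)` is Hermitian and anticommutes with `γ₀` (a `4 × 4` identity checked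
entrywise, `mesonReflect_spin_identity`).  The meson insertions do not depend on the gauge field,
`Torus.proj L (θ₀ y) = θ (Torus.proj L y)` (`proj_siteReflect`) and `θθ = 1`; finally
`conj (1/2) = 1/2` and `conj (−i/2) (P_{gf} − P_{fg}) = (−i/2) (P_{fg} − P_{gf})`.
Everything is proved; no named fact.  References: Osterwalder–Seiler 1978 §2; Montvay–Münster 1994
§4.2.3 (4.92), (4.99), §5.1.
-/

noncomputable section

open scoped BigOperators ComplexConjugate
open Literature.MathematicalPhysics.QuantumFieldTheory Literature.MathematicalPhysics.QuantumLattice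
open Literature.Probability.LatticeModels (box Site TorusSite)

namespace Summit.QuantumFields.QCD.Cruxes.StableActionBridge.Sketch

local notation "𝔾" => Matrix.specialUnitaryGroup (Fin 3) ℂ

/-! ### Spin algebra: `γ₀ (iγ₅)† γ₀ = iγ₅` entrywise -/

/-- The spin identity behind the reflection law of the pseudoscalar density, entrywise:
`∑_{α,β} conj (i (γ₅)_{αβ}) (γ₀)_{δβ} (γ₀)_{αε} = i (γ₅)_{δε}`, i.e. `γ₀ (iγ₅)† γ₀ = iγ₅`
(`γ₅ = diag(1,1,−1,−1)` is Hermitian and anticommutes with `γ₀`). -/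
theorem mesonReflect_spin_identity (δ ε : Fin 4) :
    ∑ α : Fin 4, ∑ β : Fin 4,
        starRingEnd ℂ (Complex.I * gammaFive α β) * (euclideanGamma 0 δ β * euclideanGamma 0 α ε) =
      Complex.I * gammaFive δ ε := by
  fin_cases δ <;> fin_cases ε <;>
    simp [Fin.sum_univ_four, euclideanGamma_zero, gammaFive_eq_diagonal, Matrix.diagonal_apply]

/-- Reordering a fourfold finite sum: the two inner indices move to the front. -/
theorem mesonReflect_sum_four_comm {M : Type*} [AddCommMonoid M] {ι : Type*} [Fintype ι]
    (F : ι → ι → ι → ι → M) :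
    ∑ α, ∑ β, ∑ δ, ∑ ε, F α β δ ε = ∑ δ, ∑ ε, ∑ α, ∑ β, F α β δ ε := by
  calc ∑ α, ∑ β, ∑ δ, ∑ ε, F α β δ ε
      = ∑ α, ∑ δ, ∑ β, ∑ ε, F α β δ ε := Finset.sum_congr rfl fun _ _ => Finset.sum_comm
    _ = ∑ δ, ∑ α, ∑ β, ∑ ε, F α β δ ε := Finset.sum_comm
    _ = ∑ δ, ∑ α, ∑ ε, ∑ β, F α β δ ε :=
        Finset.sum_congr rfl fun _ _ => Finset.sum_congr rfl fun _ _ => Finset.sum_comm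
    _ = ∑ δ, ∑ ε, ∑ α, ∑ β, F α β δ ε := Finset.sum_congr rfl fun _ _ => Finset.sum_comm

/-! ### `Θ_T P_{fg}(x) = P_{gf}(θx)` -/

section Bilinear

variable {Nf L : ℕ} [NeZero L]

/-- **The reflection law of the pseudoscalar density**: `Θ_T P_{fg}(x) = P_{gf}(θx)` — the flavours swap
(`ψ̄` comes from `Θ_T ψ`) and the spin matrix `iγ₅` is reproduced by `γ₀ (iγ₅)† γ₀ = iγ₅`. -/
theorem torusTheta_pseudoscalarBilinear (f g : Fin Nf) (x : TorusSite 4 L) :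
    torusTheta (pseudoscalarBilinear f g x) = pseudoscalarBilinear g f (Site.negReflect x) := by
  unfold pseudoscalarBilinear
  simp only [map_sum, LinearMap.map_smulₛₗ, torusTheta_mul, torusTheta_q, torusTheta_qbar]
  refine Finset.sum_congr rfl fun a _ => ?_
  simp_rw [Finset.sum_mul, Finset.mul_sum, smul_mul_smul_comm, Finset.smul_sum, smul_smul]
  rw [mesonReflect_sum_four_comm]
  refine Finset.sum_congr rfl fun δ _ => Finset.sum_congr rfl fun ε _ => ?_
  rw [← mesonReflect_spin_identity δ ε, Finset.sum_smul]
  refine Finset.sum_congr rfl fun α _ => ?_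
  rw [Finset.sum_smul]

end Bilinear

/-! ### The stub -/

/-- **W2a-refl (mesons): the reflection law of the pseudoscalar insertions.**  For every side `L`,
flavours `f g`, site `y ∈ ℤ⁴` and gauge field `U`,
`Θ_T (insertion (Θ'U) (pseudoRe f g) (θ₀y)) = insertion U (pseudoRe f g) y` and
`Θ_T (insertion (Θ'U) (pseudoIm f g) (θ₀y)) = insertion U (pseudoIm f g) y`
(`Θ_T P_{fg}(θx) = P_{gf}(x)`, `Θ_T` antilinear; the meson insertions do not see the gauge field). -/
theorem stub_meson_reflect : ∀ {Nf : ℕ} (L : ℕ) [NeZero L] (f g : Fin Nf) (y : Site 4) (U : GaugeConfig 4 L 𝔾),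
    torusTheta (insertion U.negReflect (QCDField.pseudoRe f g) (siteReflect y)) = insertion U (QCDField.pseudoRe f g) y ∧
    torusTheta (insertion U.negReflect (QCDField.pseudoIm f g) (siteReflect y)) = insertion U (QCDField.pseudoIm f g) y := by
  intro Nf L _ f g y U
  simp only [insertion, proj_siteReflect, LinearMap.map_smulₛₗ, map_add, map_sub,
    torusTheta_pseudoscalarBilinear, WilsonSiteRP.negReflect_negReflect]
  constructor
  · rw [add_comm]
    congr 1
    rw [map_div₀, map_one, map_ofNat]
  · rw [← neg_sub (pseudoscalarBilinear f g _), smul_neg, ← neg_smul]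
    congr 1
    rw [map_div₀, map_neg, Complex.conj_I, neg_neg, map_ofNat, neg_div]

end Summit.QuantumFields.QCD.Cruxes.StableActionBridge.Sketch

end
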